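import Summits.ResolutionOfSingularities.ResolutionOfSingularities.Theorems.PurelyInseparableDim4Equimultiple
import Summits.ResolutionOfSingularities.ResolutionOfSingularities.Theorems.PurelyInseparableDim4ChartTransfer
import Literature.AlgebraicGeometry.Resolution.BlowupRestrictOpen
import HarnessLib

/-!
# Purely inseparable four-folds: equimultiple points = order-`p` points, read ON THE BLOW-UP through a chart
# (brick TY-3c, cell `res-dim4-pi`; the composition socket for TY-2 (b))

[OURS · counted 0] (D-0157 DOOR 2 wave 2; continues `PurelyInseparableDim4Equimultiple.lean` = TY-3; host item
stmt-ResolutionOfSingularities-16155, helper). Nothing here proves resolution of singularities in dimension ≥ 4 /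
characteristic `p`. TY-3 speaks about the MODEL chart `𝔸⁵_K` carrying the hypersurface `z^p + G`,
`G = CentreBlowup.chartTransform p S j s.F`. The blow-up `π : W → 𝔸⁵_K` of the cell's target frame is reached through
an OPEN IMMERSION `f : 𝔸⁵_K ⟶ W` (the tree's `AffineCoordBlowup.chartImm`) and an ideal sheaf `I′` on `W` (the
controlled = strict transform of `(z^p + F)`) whose restriction to the chart is the model:
`I′.comap f = hypSheaf p G` — exactly the equation brick TY-2 (b) (`PurelyInseparableDim4ChartTransfer`, seat typ-2)
delivers. Orders of ideal sheaves are invariant under open immersions (tree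
`idealOrder_comap_of_isOpenImmersion`, BGMW Lemma 8.0.3 (2)), so every statement of TY-3 transfers to `W` with that
equation as a HYPOTHESIS `hI` (this file does not prove the chart equation and does not depend on typ-2's file):

* `isEquimultiplePoint_iff_idealOrder_ge_of_comap_eq` — for the `K`-rational point `x = (a, b)` of the chart with
  `a^p + G(b) = 0`: `IsEquimultiplePoint p S j b s ↔ p ≤ ord_{f x} I′`;
* `idealOrder_le_of_comap_eq` — `ord_{f x} I′ ≤ p` at rational points of the chart;
* `isClosed_singleton_of_isOpenImmersion` — a point of the chart over a closed point of `W` is closed;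
* `le_idealOrder_iff_of_isClosed_of_mem_range` — `K` algebraically closed: a CLOSED point `w` of `W` inside the
  chart has `ord_w I′ ≥ p` iff `w = f(a, b)` with `a^p + G(b) = 0` and `IsEquimultiplePoint p S j b s`;
* `mem_support_iff_of_comap_eq` — the same for the support of a marked ideal `(I′, E′, p)` on `W`, BGMW Def. 3.1.2.
* §2 (UNCONDITIONAL, with typ-2's TY-2 (b) `ChartDictionary.controlledTransform_comap_chartImm`, p647325): for ANY
  blowing up `π : W → 𝔸⁵_K` along `V(z, x_S)` (`IsBlowup π 𝓘Λ`), `j ∈ S`, `p ≤ ord_{(x_S)} F`: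
  **`isEquimultiplePoint_iff_idealOrder_controlledTransform_ge`** — `IsEquimultiplePoint p S j b s ↔
  p ≤ ord_{chartImm (a,b)} σᶜ((z^p + F), p)`; `le_idealOrder_controlledTransform_iff_of_isClosed` (`K = K̄`, closed
  points of the `x_j`-chart of `W`); `mem_support_transform_iff` (support of the transformed marked ideal
  `(⟨(z^p + F), E, p⟩).transform π 𝓘Λ`) — S3 (b) of the cell's line, on the blow-up itself.

AI-produced formalisation, weaker than expert review. bears_on: LADDER-RESOLUTION:D157-DOOR2 (res-dim4-pi · TY-3c).
-/

set_option linter.dupNamespace false -- D-0017: single-problem summit path `Summit.<S>.<S>.…` by design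

noncomputable section

open MvPolynomial Finset AlgebraicGeometry

namespace Summit.ResolutionOfSingularities.ResolutionOfSingularities.Theorems.PIDim4

open Literature.AlgebraicGeometry.Resolution
open Literature.AlgebraicGeometry.Resolution.Hauser2010

namespace Equimultiple

section OnBlowup

variable {K : Type} [Field K] {p : ℕ} [hp : Fact p.Prime] [CharP K p]
variable {W : Scheme.{0}} (f : AffinePointBlowup.P 4 K ⟶ W) [IsOpenImmersion f] (I' : W.IdealSheafData)

/-- **TY-3 through a chart of the blow-up.** If the ideal sheaf `I′` on `W` restricts along the open immersion
`f : 𝔸⁵_K ⟶ W` to the model hypersurface sheaf `(z^p + G)`, `G = chartTransform p S j s.F`, then at the rational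
point `x = (a, b)` of the chart lying on `V(z^p + G)`: `IsEquimultiplePoint p S j b s ↔ p ≤ ord_{f x} I′`.
[cite: BierstoneGrigorievMilmanWlodarczyk2011, Lemma 8.0.3 (2) (orders are étale-local)] [cite: Hauser2010, §F (equiconstant points)] -/
theorem isEquimultiplePoint_iff_idealOrder_ge_of_comap_eq (S : Finset (Fin 4)) (j : Fin 4) (b : Fin 4 → K)
    (s : State K) (a : K) (hab : a ^ p + eval b (CentreBlowup.chartTransform p S j s.F) = 0)
    (hI : I'.comap f = hypSheaf p (CentreBlowup.chartTransform p S j s.F)) {x : AffinePointBlowup.P 4 K}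
    (hx : x.asIdeal = MvPolynomial.vanishingIdeal K {(Fin.cons a b : Fin (4 + 1) → K)}) :
    CentreBlowup.IsEquimultiplePoint p S j b s ↔ (p : ℕ∞) ≤ idealOrder I' (f x) := by
  rw [← idealOrder_comap_of_isOpenImmersion f I' x, hI]
  exact isEquimultiplePoint_iff_idealOrder_ge S j b s a hab hx

/-- `ord_{f x} I′ ≤ p` at every rational point `x` of the chart (the hypersurface has multiplicity `≤ p`).
[cite: Hauser2010, §C (order of X at a point)] -/
theorem idealOrder_le_of_comap_eq (G : MvPolynomial (Fin 4) K) (hI : I'.comap f = hypSheaf p G)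
    {x : AffinePointBlowup.P 4 K} (a : K) (b : Fin 4 → K)
    (hx : x.asIdeal = MvPolynomial.vanishingIdeal K {(Fin.cons a b : Fin (4 + 1) → K)}) :
    idealOrder I' (f x) ≤ p := by
  rw [← idealOrder_comap_of_isOpenImmersion f I' x, hI]
  exact idealOrder_hypSheaf_le G a b hx

omit hp [CharP K p] in
/-- A point of the chart lying over a CLOSED point of `W` is a closed point of the chart (`f` is a topological
embedding). [cite: StacksProject, Tag 01J7] -/
theorem isClosed_singleton_of_isOpenImmersion {x : AffinePointBlowup.P 4 K}
    (hw : IsClosed ({f x} : Set W)) : IsClosed ({x} : Set (AffinePointBlowup.P 4 K)) := by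
  have hinj : Function.Injective f := f.isOpenEmbedding.injective
  have : ({x} : Set (AffinePointBlowup.P 4 K)) = f ⁻¹' {f x} := by
    ext y
    simp only [Set.mem_singleton_iff, Set.mem_preimage]
    exact ⟨fun h => by rw [h], fun h => hinj h⟩
  rw [this]
  exact hw.preimage f.continuous

/-- **`K` algebraically closed: the CLOSED points of order `≥ p` of `I′` inside the chart `f(𝔸⁵_K) ⊆ W` are exactly
the images of the points `(a, b)` with `a^p + G(b) = 0` and `IsEquimultiplePoint p S j b s`** (S3 (b) on the blow-up,
given the chart equation `hI` of TY-2 (b)). [cite: Hauser2010, §F (equiconstant points)]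
[cite: BierstoneGrigorievMilmanWlodarczyk2011, Lemma 8.0.3 (2)] -/
theorem le_idealOrder_iff_of_isClosed_of_mem_range [IsAlgClosed K] (S : Finset (Fin 4)) (j : Fin 4) (s : State K)
    (hI : I'.comap f = hypSheaf p (CentreBlowup.chartTransform p S j s.F)) {w : W}
    (hw : IsClosed ({w} : Set W)) (hwf : w ∈ Set.range f) :
    (p : ℕ∞) ≤ idealOrder I' w ↔
      ∃ (x : AffinePointBlowup.P 4 K) (a : K) (b : Fin 4 → K), f x = w ∧
        x.asIdeal = MvPolynomial.vanishingIdeal K {(Fin.cons a b : Fin (4 + 1) → K)} ∧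
          a ^ p + eval b (CentreBlowup.chartTransform p S j s.F) = 0 ∧ CentreBlowup.IsEquimultiplePoint p S j b s := by
  obtain ⟨x, rfl⟩ := hwf
  have hx : IsClosed ({x} : Set (AffinePointBlowup.P 4 K)) := isClosed_singleton_of_isOpenImmersion f hw
  rw [← idealOrder_comap_of_isOpenImmersion f I' x, hI, le_idealOrder_hypSheaf_iff_of_isClosed S j s hx]
  constructor
  · rintro ⟨a, b, hab, hroot, heq⟩
    exact ⟨x, a, b, rfl, hab, hroot, heq⟩
  · rintro ⟨x', a, b, hxx', hab, hroot, heq⟩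
    obtain rfl : x' = x := f.isOpenEmbedding.injective hxx'
    exact ⟨a, b, hab, hroot, heq⟩

/-- The same for the support `{ord ≥ p}` of a marked ideal `(I′, E′, p)` on `W` (e.g. the transform
`MarkedIdeal.transform π C ⟨hypSheaf p F, E, p⟩`, whose ideal is the controlled transform).
[cite: BierstoneGrigorievMilmanWlodarczyk2011, Def. 3.1.2 and Def. 3.1.3 (3)] -/
theorem mem_support_iff_of_comap_eq (M' : MarkedIdeal W) (hmult : M'.mult = p) (S : Finset (Fin 4)) (j : Fin 4)
    (b : Fin 4 → K) (s : State K) (a : K) (hab : a ^ p + eval b (CentreBlowup.chartTransform p S j s.F) = 0)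
    (hI : M'.ideal.comap f = hypSheaf p (CentreBlowup.chartTransform p S j s.F)) {x : AffinePointBlowup.P 4 K}
    (hx : x.asIdeal = MvPolynomial.vanishingIdeal K {(Fin.cons a b : Fin (4 + 1) → K)}) :
    f x ∈ M'.support ↔ CentreBlowup.IsEquimultiplePoint p S j b s := by
  rw [isEquimultiplePoint_iff_idealOrder_ge_of_comap_eq f M'.ideal S j b s a hab hI hx, MarkedIdeal.support,
    Set.mem_setOf_eq, hmult]

end OnBlowup

/-! ## §2 Unconditional form on the blow-up of `𝔸⁵_K` along `V(z, x_S)` (with TY-2 (b)) -/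

section Blowup

variable {K : Type} [Field K] {p : ℕ} [hp : Fact p.Prime] [CharP K p]
variable {S : Finset (Fin 4)} {j : Fin 4} {W : Scheme.{0}} {π : W ⟶ AffinePointBlowup.P 4 K}

/-- **S3 (b) on the blow-up.** For ANY blowing up `π : W → 𝔸⁵_K` along `V(z, x_S)`, `j ∈ S`, `p ≤ ord_{(x_S)} F`
(Hironaka-permissibility of the centre for `z^p + F`), and the rational point `x = (a, b)` of the `x_j`-chart with
`a^p + F′(b) = 0` (`F′ = chartTransform p S j F`): `b` is an equimultiple point of the model iff the controlled
transform `σᶜ((z^p + F)·𝒪, p)` has order `≥ p` at the point `chartImm x` of `W`.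
[cite: BierstoneGrigorievMilmanWlodarczyk2011, §3.2 (controlled transform) and Lemma 8.0.3 (2)]
[cite: Hauser2010, §F (equiconstant points)] -/
theorem isEquimultiplePoint_iff_idealOrder_controlledTransform_ge (hj : j ∈ S) (s : State K)
    (hperm : (p : ℕ∞) ≤ CentreBlowup.ordAlong S s.F)
    (hπ : IsBlowup π (AffineCoordBlowup.𝓘Λ 4 K (insert 0 (Fin.succ '' (S : Set (Fin 4))))))
    (b : Fin 4 → K) (a : K) (hab : a ^ p + eval b (CentreBlowup.chartTransform p S j s.F) = 0)
    {x : AffinePointBlowup.P 4 K} (hx : x.asIdeal = MvPolynomial.vanishingIdeal K {(Fin.cons a b : Fin (4 + 1) → K)}) :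
    CentreBlowup.IsEquimultiplePoint p S j b s ↔
      (p : ℕ∞) ≤ idealOrder (controlledTransform π
        (AffineCoordBlowup.𝓘Λ 4 K (insert 0 (Fin.succ '' (S : Set (Fin 4))))) (hypSheaf p s.F) p)
        (AffineCoordBlowup.chartImm hπ (ChartDictionary.succ_mem_centreVars hj) x) :=
  isEquimultiplePoint_iff_idealOrder_ge_of_comap_eq _ _ S j b s a hab
    (ChartDictionary.controlledTransform_comap_chartImm p hj s.F hperm hπ) hx

/-- **`K` algebraically closed: the closed points of order `≥ p` of the controlled transform inside the `x_j`-chart of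
`W` are exactly the `chartImm (a, b)` with `a^p + F′(b) = 0` and `IsEquimultiplePoint p S j b s`.**
[cite: Hauser2010, §F (equiconstant points)] [cite: BierstoneGrigorievMilmanWlodarczyk2011, Lemma 8.0.3 (2)] -/
theorem le_idealOrder_controlledTransform_iff_of_isClosed [IsAlgClosed K] (hj : j ∈ S) (s : State K)
    (hperm : (p : ℕ∞) ≤ CentreBlowup.ordAlong S s.F)
    (hπ : IsBlowup π (AffineCoordBlowup.𝓘Λ 4 K (insert 0 (Fin.succ '' (S : Set (Fin 4)))))) {w : W}
    (hw : IsClosed ({w} : Set W))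
    (hwf : w ∈ Set.range (AffineCoordBlowup.chartImm hπ (ChartDictionary.succ_mem_centreVars hj))) :
    (p : ℕ∞) ≤ idealOrder (controlledTransform π
        (AffineCoordBlowup.𝓘Λ 4 K (insert 0 (Fin.succ '' (S : Set (Fin 4))))) (hypSheaf p s.F) p) w ↔
      ∃ (x : AffinePointBlowup.P 4 K) (a : K) (b : Fin 4 → K),
        AffineCoordBlowup.chartImm hπ (ChartDictionary.succ_mem_centreVars hj) x = w ∧
          x.asIdeal = MvPolynomial.vanishingIdeal K {(Fin.cons a b : Fin (4 + 1) → K)} ∧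
            a ^ p + eval b (CentreBlowup.chartTransform p S j s.F) = 0 ∧
              CentreBlowup.IsEquimultiplePoint p S j b s :=
  le_idealOrder_iff_of_isClosed_of_mem_range _ _ S j s
    (ChartDictionary.controlledTransform_comap_chartImm p hj s.F hperm hπ) hw hwf

/-- The same for the support of the TRANSFORMED MARKED IDEAL `(⟨(z^p + F), E, p⟩).transform π 𝓘Λ` of the target
frame (BGMW Def. 3.1.3 (3): its ideal is the controlled transform, its multiplicity `p`).
[cite: BierstoneGrigorievMilmanWlodarczyk2011, Def. 3.1.2 and Def. 3.1.3 (3)] -/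
theorem mem_support_transform_iff (hj : j ∈ S) (s : State K) (hperm : (p : ℕ∞) ≤ CentreBlowup.ordAlong S s.F)
    (hπ : IsBlowup π (AffineCoordBlowup.𝓘Λ 4 K (insert 0 (Fin.succ '' (S : Set (Fin 4))))))
    (E : List (AffinePointBlowup.P 4 K).IdealSheafData) (b : Fin 4 → K) (a : K)
    (hab : a ^ p + eval b (CentreBlowup.chartTransform p S j s.F) = 0) {x : AffinePointBlowup.P 4 K}
    (hx : x.asIdeal = MvPolynomial.vanishingIdeal K {(Fin.cons a b : Fin (4 + 1) → K)}) :
    AffineCoordBlowup.chartImm hπ (ChartDictionary.succ_mem_centreVars hj) x ∈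
        ((⟨hypSheaf p s.F, E, p⟩ : MarkedIdeal (AffinePointBlowup.P 4 K)).transform π
          (AffineCoordBlowup.𝓘Λ 4 K (insert 0 (Fin.succ '' (S : Set (Fin 4)))))).support ↔
      CentreBlowup.IsEquimultiplePoint p S j b s :=
  mem_support_iff_of_comap_eq (p := p) _ _ rfl S j b s a hab
    (by rw [MarkedIdeal.transform_ideal]
        exact ChartDictionary.controlledTransform_comap_chartImm p hj s.F hperm hπ) hx

end Blowup

end Equimultiple

end Summit.ResolutionOfSingularities.ResolutionOfSingularities.Theorems.PIDim4

end
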